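import Summits.HubbardSuperconductivity.HubbardSuperconductivity.Theorems.AnisotropyChordTransferFibre3B1WLoopBracket
import Summits.HubbardSuperconductivity.HubbardSuperconductivity.Theorems.AnisotropyChordTransferFibre3B1EvalSound

/-!
# Route `AnisotropyChord` / H0 rotor rung, LEVEL 2 family B1: the exact-integer KERNEL EVALUATOR of the weighted-upper loop
bracket (row D Stage 2) and its SOUNDNESS

`…Fibre3B1WLoopBracket.wloop_upper_cell` bounds `θ⁴·wloopSum L (νθ²) s₀ s₁ s₂ e₁ e₂` on a whole ν-cell `0 ≤ ν ≤ ν₂` by the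
L-independent `hiSumW ν₂ θ₀ K S … + c_Z(ν₂)·tailConst ν₂ (K − 2S) 2`.  THIS FILE turns that into ONE kernel `decide` per
(object, ν-band), reusing the integer machinery of `…Fibre3B1Eval` (`gridSum`, `hiDen`, `hiTermZ`, `hiDenPos`, `piHi`, `tailConstQ`):
* `wWeightZ` — the integer window weight `|(p+s₁)·e₁|·|(p+s₂)·e₂|`;
* `hiTermWZ`, `hiSumWZ νn νd Tn Td K S s e D = gridSum (hiTermZ … (sh3 s) 1 3 (D·wWeightZ))` — an UPPER bound of
  `D·hiSumW (νn/νd) θ₀ …` whenever `θ₀²·Td ≤ Tn` and `hiDenPos` (`hiSumW_le_hiSumWZ`; the weight rides in the rounding scale);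
* `cZQ νn νd = piHi²/(4 − piHi²·νn/νd) ≥ c_Z(νn/νd)` (`cZ_le_cZQ`);
* ★ `wCheck L₀ n₂ νd Tn Td S s₀ s₁ s₂ e₁ e₂ D chi : Bool` — the side conditions of `wloop_upper_cell` at `θ₀ = 2π/L₀`, `K = L₀/4`
  and the evaluation `hiSumWZ(n₂) ≤ (chi − cZQ(n₂)·tailConstQ(n₂, K − 2S, 2))·D`;
* ★★ `w_sound`: `wCheck … = true` ⟹ for every `L ≥ L₀` and every `0 ≤ ν ≤ n₂/νd`:
  `θ⁴ · wloopSum L (νθ²) s₀ s₁ s₂ e₁ e₂ ≤ chi`  (`θ = 2π/L`).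
This is the kernel interface p1's row-D cell program consumes (one rational `chi` per object and ν-band, either as a
`classCheck` parameter or as a box atom).
Prover seat `hubbard-h0-rotor-p2` g7; helper for piece A = stmt-HubbardSuperconductivity-23918 of rung 19089
(`--supports`, helper class).  Nothing here proves superconductivity in the Hubbard model; helper definitions/lemmas of ONE
conditional reduction (the GM₃ ∀L certificate, Level-2 row D); the rotor TARGET as originally worded stays FALSE (g15 verdict).
Mathlib + the tree only; no sorry.
-/

set_option linter.dupNamespace false
set_option autoImplicit false

open scoped BigOperators

namespace Summit.HubbardSuperconductivity.HubbardSuperconductivity.Theorems.AnisotropyChord.Transfer.Fibre3.B1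

open L2.N1

/-! ## The evaluator (computable layer) -/

/-- the integer window weight `|(p + s₁)·e₁| · |(p + s₂)·e₂|`. -/
def wWeightZ (s₁ s₂ e₁ e₂ p : ℤ × ℤ) : ℤ := |qdot (p + s₁) e₁| * |qdot (p + s₂) e₂|

/-- one rounded-up weighted window term: the three-factor `hiTermZ` of `…Fibre3B1Eval` at the scale `D·w(p)`
(`⌊D·w(p)·(12Tdνd)³/Π hiDen⌋ + 1` on the index set, `0` off it). -/
def hiTermWZ (νn νd Tn Td : ℤ) (K : ℕ) (s₀ s₁ s₂ e₁ e₂ : ℤ × ℤ) (D : ℕ) (p : ℤ × ℤ) : ℤ :=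
  hiTermZ νn νd Tn Td K (sh3 s₀ s₁ s₂) (fun _ => 1) 3 (D * (wWeightZ s₁ s₂ e₁ e₂ p).toNat) p

/-- `hiSumWZ ≥ D · hiSumW (νn/νd) θ₀ K S …` for `θ₀²·Td ≤ Tn` and `hiDenPos` (`hiSumW_le_hiSumWZ`): the grid loop of `hiTermWZ`. -/
def hiSumWZ (νn νd Tn Td : ℤ) (K S : ℕ) (s₀ s₁ s₂ e₁ e₂ : ℤ × ℤ) (D : ℕ) : ℤ :=
  gridSum (K + S) (hiTermWZ νn νd Tn Td K s₀ s₁ s₂ e₁ e₂ D)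

/-- `c_Z(νn/νd)` with `π ↦ piHi`: `piHi² / (4 − piHi²·νn/νd)` (an upper bound, `cZ_le_cZQ`). -/
def cZQ (νn νd : ℤ) : ℚ := piHi ^ 2 / (4 - piHi ^ 2 * ((νn : ℚ) / νd))

/-- ★ THE CERTIFICATE of one weighted loop object on the ν-band `[0, n₂/νd]` at `θ₀ = 2π/L₀`, `K = L₀/4`:
side conditions of `wloop_upper_cell` (`0 < νd`, `0 < Td`, `0 ≤ n₂`, `n₂/νd·piHi² < 4`, `(2·piHi/L₀)²·Td ≤ Tn`, `2 + 2S ≤ K`,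
`e₁, e₂ ∈ E4`, `|s_i|∞ ≤ S`, `hiDenPos`) and the evaluation `hiSumWZ(n₂) ≤ (chi − cZQ(n₂)·tailConstQ(n₂, K − 2S, 2))·D`. -/
def wCheck (L0 : ℕ) (n2 νd Tn Td : ℤ) (S : ℕ) (s₀ s₁ s₂ e₁ e₂ : ℤ × ℤ) (D : ℕ) (chi : ℚ) : Bool :=
  decide (0 < νd) && decide (0 < Td) && decide (0 ≤ n2) &&
  decide ((n2 : ℚ) / νd * piHi ^ 2 < 4) &&
  decide ((2 * piHi / L0) ^ 2 * Td ≤ Tn) &&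
  decide (2 + 2 * S ≤ L0 / 4) && decide (0 < D) &&
  decide (e₁ ∈ E4) && decide (e₂ ∈ E4) &&
  (decide (s₀.1.natAbs ≤ S) && decide (s₀.2.natAbs ≤ S)) &&
  (decide (s₁.1.natAbs ≤ S) && decide (s₁.2.natAbs ≤ S)) &&
  (decide (s₂.1.natAbs ≤ S) && decide (s₂.2.natAbs ≤ S)) &&
  hiDenPos n2 νd Tn Td (L0 / 4) &&
  decide (((hiSumWZ n2 νd Tn Td (L0 / 4) S s₀ s₁ s₂ e₁ e₂ D : ℤ) : ℚ)
      ≤ (chi - cZQ n2 νd * tailConstQ n2 νd (L0 / 4 - 2 * S) 2) * D)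

/-! ## Soundness -/

section sound

/-- the real weight is the cast of the integer weight. [folklore] -/
theorem wWeight_eq_cast (s₁ s₂ e₁ e₂ p : ℤ × ℤ) : wWeight s₁ s₂ e₁ e₂ p = ((wWeightZ s₁ s₂ e₁ e₂ p : ℤ) : ℝ) := by
  unfold wWeight wWeightZ
  push_cast
  rfl

/-- ★ UPPER evaluation: `D · hiSumW (νn/νd) θ₀ ≤ hiSumWZ` for `θ₀²·Td ≤ Tn` and `hiDenPos`. -/
theorem hiSumW_le_hiSumWZ (νn νd Tn Td : ℤ) (hνd : 0 < νd) (hTd : 0 < Td) (θ0 : ℝ) (hT : θ0 ^ 2 * Td ≤ Tn)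
    (K S : ℕ) (hpos : hiDenPos νn νd Tn Td K = true) (s₀ s₁ s₂ e₁ e₂ : ℤ × ℤ) (D : ℕ) :
    (D : ℝ) * hiSumW ((νn : ℝ) / νd) θ0 K S s₀ s₁ s₂ e₁ e₂
      ≤ ((hiSumWZ νn νd Tn Td K S s₀ s₁ s₂ e₁ e₂ D : ℤ) : ℝ) := by
  unfold hiSumWZ hiSumW
  rw [cast_gridSum, sum_idx_eq_grid, Finset.mul_sum]
  refine Finset.sum_le_sum fun i _ => ?_
  rw [Finset.mul_sum]
  refine Finset.sum_le_sum fun j _ => ?_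
  set p := boxPt (K + S) i j with hp
  unfold hiTermWZ
  have hw0Z : 0 ≤ wWeightZ s₁ s₂ e₁ e₂ p := by unfold wWeightZ; positivity
  have hcast : (((D * (wWeightZ s₁ s₂ e₁ e₂ p).toNat : ℕ)) : ℝ) = (D : ℝ) * wWeight s₁ s₂ e₁ e₂ p := by
    rw [wWeight_eq_cast]
    push_cast
    congr 1
    exact_mod_cast Int.toNat_of_nonneg hw0Z
  have hterm := hiTerm_le_hiTermZ νn νd Tn Td hνd hTd θ0 hT K hpos (sh3 s₀ s₁ s₂) (fun _ => 1) 3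
    (D * (wWeightZ s₁ s₂ e₁ e₂ p).toNat) (by simp) p
  rw [hcast] at hterm
  by_cases h : allWin K (sh3 s₀ s₁ s₂) p = true
  · rw [if_pos h] at hterm ⊢
    have e : (D : ℝ) * (wWeight s₁ s₂ e₁ e₂ p * ∏ i, (1 / (winE θ0 (p + sh3 s₀ s₁ s₂ i) - (νn : ℝ) / νd)))
        = (D : ℝ) * wWeight s₁ s₂ e₁ e₂ p * ∏ t, (1 / (winE θ0 (p + sh3 s₀ s₁ s₂ t) - (νn : ℝ) / νd)) ^ (1 : ℕ) := by
      simp_rw [pow_one]; ring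
    rw [e]
    exact hterm
  · rw [if_neg h] at hterm ⊢
    rw [mul_zero]
    exact hterm

/-- ★ `c_Z(νn/νd) ≤ cZQ` for `νn ≥ 0`, `νd > 0`, `νn/νd·piHi² < 4` (`c_Z` is increasing in `π`). [folklore] -/
theorem cZ_le_cZQ (νn νd : ℤ) (hνd : 0 < νd) (hν0 : 0 ≤ νn) (hc : (νn : ℚ) / νd * piHi ^ 2 < 4) :
    RowD.cZ ((νn : ℝ) / νd) ≤ ((cZQ νn νd : ℚ) : ℝ) := by
  have hpi := Real.pi_pos
  have hP : Real.pi ≤ ((piHi : ℚ) : ℝ) := by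
    have e : ((piHi : ℚ) : ℝ) = 3.1416 := by unfold piHi; norm_num
    rw [e]
    exact Real.pi_lt_d4.le
  set P : ℝ := ((piHi : ℚ) : ℝ) with hPdef
  have hνR : (0 : ℝ) ≤ (νn : ℝ) / νd := by
    have : (0 : ℝ) < νd := by exact_mod_cast hνd
    have : (0 : ℝ) ≤ νn := by exact_mod_cast hν0
    positivity
  have hcR : (νn : ℝ) / νd * P ^ 2 < 4 := by rw [hPdef]; exact_mod_cast hc
  have hPP : Real.pi ^ 2 ≤ P ^ 2 := pow_le_pow_left₀ hpi.le hP 2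
  have e : ((cZQ νn νd : ℚ) : ℝ) = P ^ 2 / (4 - P ^ 2 * ((νn : ℝ) / νd)) := by
    rw [hPdef]; unfold cZQ; push_cast; ring
  rw [e]
  unfold RowD.cZ
  have hden : 0 < 4 - P ^ 2 * ((νn : ℝ) / νd) := by nlinarith
  apply div_le_div₀ (by positivity) hPP hden
  nlinarith [mul_le_mul_of_nonneg_right hPP hνR]

/-- ★★ **SOUNDNESS OF THE WEIGHTED-LOOP CERTIFICATE**: if `wCheck L₀ n₂ νd Tn Td S s₀ s₁ s₂ e₁ e₂ D chi = true` then for every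
`L ≥ L₀` and every `0 ≤ ν ≤ n₂/νd`:  `((2π/L)²)² · wloopSum L (ν·(2π/L)²) s₀ s₁ s₂ e₁ e₂ ≤ chi`. -/
theorem w_sound (L0 : ℕ) (n2 νd Tn Td : ℤ) (S : ℕ) (s₀ s₁ s₂ e₁ e₂ : ℤ × ℤ) (D : ℕ) (chi : ℚ)
    (h : wCheck L0 n2 νd Tn Td S s₀ s₁ s₂ e₁ e₂ D chi = true)
    (L : ℕ) [NeZero L] (hL : L0 ≤ L) (ν : ℝ) (hν0 : 0 ≤ ν) (hν2 : ν ≤ (n2 : ℝ) / νd) :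
    ((2 * Real.pi / L) ^ 2) ^ 2 * wloopSum L (ν * (2 * Real.pi / L) ^ 2) s₀ s₁ s₂ e₁ e₂ ≤ ((chi : ℚ) : ℝ) := by
  unfold wCheck at h
  simp only [Bool.and_eq_true, decide_eq_true_eq] at h
  obtain ⟨⟨⟨⟨⟨⟨⟨⟨⟨⟨⟨⟨⟨hνd, hTd⟩, hn2⟩, hc⟩, hT⟩, hK⟩, hD⟩, he₁⟩, he₂⟩, hs₀⟩, hs₁⟩, hs₂⟩, hpos⟩, hhi⟩ := h
  have hpi := Real.pi_pos
  have hP : Real.pi ≤ ((piHi : ℚ) : ℝ) := by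
    have e : ((piHi : ℚ) : ℝ) = 3.1416 := by unfold piHi; norm_num
    rw [e]
    exact Real.pi_lt_d4.le
  -- the cell endpoint
  have hνdR : (0 : ℝ) < νd := by exact_mod_cast hνd
  have hn2R : (0 : ℝ) ≤ (n2 : ℝ) / νd := div_nonneg (by exact_mod_cast hn2) hνdR.le
  have hcR : (n2 : ℝ) / νd * (((piHi : ℚ) : ℝ)) ^ 2 < 4 := by exact_mod_cast hc
  have hν2_lt : (n2 : ℝ) / νd < 4 / Real.pi ^ 2 := by
    rw [lt_div_iff₀ (by positivity)]
    have : Real.pi ^ 2 ≤ (((piHi : ℚ) : ℝ)) ^ 2 := pow_le_pow_left₀ hpi.le hP 2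
    nlinarith
  -- scales
  have hL0pos : 0 < L0 := by omega
  obtain ⟨hθ0, hθ0K⟩ := scales_of_L0 L L0 hL0pos hL
  -- the bracket on the cell
  have hmain := wloop_upper_cell L (2 * Real.pi / L0) (L0 / 4) S s₀ s₁ s₂ e₁ e₂ he₁ he₂
    (sh3_small S s₀ s₁ s₂ hs₀ hs₁ hs₂) hK hθ0 hθ0K ν ((n2 : ℝ) / νd) hν0 hν2 hν2_lt
  -- T dominates θ₀²
  have hL0R : (0 : ℝ) < L0 := by exact_mod_cast hL0pos
  have hTR : (2 * Real.pi / L0) ^ 2 * (Td : ℝ) ≤ Tn := by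
    have h1 : (2 * Real.pi / L0) ^ 2 ≤ (2 * (((piHi : ℚ) : ℝ)) / L0) ^ 2 := by
      apply pow_le_pow_left₀ (by positivity)
      exact div_le_div_of_nonneg_right (by linarith) hL0R.le
    have h2' : (2 * (((piHi : ℚ) : ℝ)) / L0) ^ 2 * (Td : ℝ) ≤ Tn := by exact_mod_cast hT
    have hTd' : (0 : ℝ) < Td := by exact_mod_cast hTd
    nlinarith
  -- the three evaluations
  have hDR : (0 : ℝ) < D := by exact_mod_cast hD
  have ehi := hiSumW_le_hiSumWZ n2 νd Tn Td hνd hTd (2 * Real.pi / L0) hTR (L0 / 4) S hpos s₀ s₁ s₂ e₁ e₂ D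
  have ecz := cZ_le_cZQ n2 νd hνd hn2 hc
  have etail := tailConst_le_tailConstQ n2 νd hνd hn2 hc (L0 / 4 - 2 * S) 2 (by omega)
  have hhiR : ((hiSumWZ n2 νd Tn Td (L0 / 4) S s₀ s₁ s₂ e₁ e₂ D : ℤ) : ℝ)
      ≤ (((chi : ℚ) : ℝ) - ((cZQ n2 νd : ℚ) : ℝ) * ((tailConstQ n2 νd (L0 / 4 - 2 * S) 2 : ℚ) : ℝ)) * D := by
    exact_mod_cast hhi
  have hcz0 : 0 ≤ RowD.cZ ((n2 : ℝ) / νd) := (RowD.cZ_pos hν2_lt).le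
  have hK'2 : 2 ≤ L0 / 4 - 2 * S := by omega
  have hK'R : (2 : ℝ) ≤ ((L0 / 4 - 2 * S : ℕ) : ℝ) := by exact_mod_cast hK'2
  have hpi3 := Real.pi_gt_three
  have hc1 : (n2 : ℝ) / νd * Real.pi ^ 2 / 4 < 1 := by
    rw [div_lt_one (by norm_num)]
    have := (lt_div_iff₀ (by positivity)).mp hν2_lt
    linarith
  have ht0 : 0 ≤ tailConst ((n2 : ℝ) / νd) (L0 / 4 - 2 * S) 2 := by
    unfold tailConst
    have hD1 : 0 < (((L0 / 4 - 2 * S : ℕ) : ℝ) + 1) ^ 2 - (n2 : ℝ) / νd * Real.pi ^ 2 / 4 := by nlinarith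
    have hD2 : 0 < ((L0 / 4 - 2 * S : ℕ) : ℝ) ^ 2 - (n2 : ℝ) / νd * Real.pi ^ 2 / 4 := by nlinarith
    positivity
  have hprod : RowD.cZ ((n2 : ℝ) / νd) * tailConst ((n2 : ℝ) / νd) (L0 / 4 - 2 * S) 2
      ≤ ((cZQ n2 νd : ℚ) : ℝ) * ((tailConstQ n2 νd (L0 / 4 - 2 * S) 2 : ℚ) : ℝ) :=
    mul_le_mul ecz etail ht0 (hcz0.trans ecz)
  have hwin : hiSumW ((n2 : ℝ) / νd) (2 * Real.pi / L0) (L0 / 4) S s₀ s₁ s₂ e₁ e₂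
      ≤ ((chi : ℚ) : ℝ) - ((cZQ n2 νd : ℚ) : ℝ) * ((tailConstQ n2 νd (L0 / 4 - 2 * S) 2 : ℚ) : ℝ) := by
    rw [← mul_le_mul_iff_left₀ hDR]
    calc hiSumW ((n2 : ℝ) / νd) (2 * Real.pi / L0) (L0 / 4) S s₀ s₁ s₂ e₁ e₂ * D
        = (D : ℝ) * hiSumW ((n2 : ℝ) / νd) (2 * Real.pi / L0) (L0 / 4) S s₀ s₁ s₂ e₁ e₂ := mul_comm _ _
      _ ≤ _ := ehi
      _ ≤ _ := hhiR
  linarith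

end sound

end Summit.HubbardSuperconductivity.HubbardSuperconductivity.Theorems.AnisotropyChord.Transfer.Fibre3.B1
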